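import Mathlib
import HarnessLib

/-!
# Stub `stub_asymptotics` of the line `Sketch` (log-window-tagged-tail) for the crux
`RelayRaceLocality.GibbsLightCone` (stmt-AtomisticToContinuum-12501)

Registered stub of the lead prover's skeleton (`Cruxes/GibbsLightCone/Lines/Sketch.lean`): the
window bookkeeping of the log-window union bound. For `t, θ, σ, c > 0` and any `C` there are, for
every `N`, a positive integer number of windows `n_N` and a window length of `M_N` mean-free-time
units `τ_N = (N+1)^{-1/3} / (σ² √θ)` with `n_N · M_N · τ_N = t` exactly, `M_N ≥ 1` eventually and
`(N+1) · n_N · C e^{-c M_N} → 0`.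

Since the four clauses do not bound `M_N` from above, the single window `n_N = 1`,
`M_N = t / τ_N = t σ² √θ (N+1)^{1/3}` already satisfies them: `M_N → ∞`, and
`(N+1) · C · exp(-c t σ² √θ (N+1)^{1/3}) → 0` because a stretched exponential beats any power
(`tendsto_rpow_mul_exp_neg_mul_atTop_nhds_zero` composed with `x ↦ x^{1/3}`). Pure real analysis
over Mathlib; no project declarations are used.
-/

namespace Summit.AtomisticToContinuum.HydrodynamicLimit.Theorems.LogWindowTaggedTail

open MeasureTheory Filter Set

/-- Stretched-exponential decay beats a linear factor: for `a, c > 0` and any `C`,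
`x · C · exp (-c · (a · x^{1/3})) → 0` as `x → ∞` (substitute `y = x^{1/3}` in
`y³ e^{-(ca) y} → 0`). [folklore] -/
theorem asymptotics_tendsto_mul_exp_neg_rpow_third (a c C : ℝ) (ha : 0 < a) (hc : 0 < c) :
    Tendsto (fun x : ℝ => x * (C * Real.exp (-c * (a * x ^ (1 / 3 : ℝ))))) atTop (nhds 0) := by
  have h1 : Tendsto (fun x : ℝ => (x ^ (1 / 3 : ℝ)) ^ (3 : ℝ) *
      Real.exp (-(c * a) * x ^ (1 / 3 : ℝ))) atTop (nhds 0) :=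
    (tendsto_rpow_mul_exp_neg_mul_atTop_nhds_zero 3 (c * a) (mul_pos hc ha)).comp
      (tendsto_rpow_atTop (by norm_num : (0 : ℝ) < 1 / 3))
  have h2 := h1.const_mul C
  rw [mul_zero] at h2
  refine h2.congr' ?_
  filter_upwards [eventually_ge_atTop 0] with x hx
  rw [← Real.rpow_mul hx, show (1 / 3 : ℝ) * 3 = 1 by norm_num, Real.rpow_one,
    show -(c * a) * x ^ (1 / 3 : ℝ) = -c * (a * x ^ (1 / 3 : ℝ)) by ring]
  ring

/-- WINDOW BOOKKEEPING (registered stub `stub_asymptotics` of the line `Sketch` for the crux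
`GibbsLightCone`, stmt-AtomisticToContinuum-12501; pure real analysis): for `t, θ, σ, c > 0` and
any `C` there are, for every `N`, a positive integer `n_N` of windows and a window length of `M_N`
mean-free-time units `τ_N = (N+1)^{-1/3} / (σ² √θ)` with `n_N · M_N · τ_N = t` exactly, such that
`M_N ≥ 1` eventually and `(N+1) · n_N · C e^{-c M_N} → 0`. Witness: one window, `n_N = 1`,
`M_N = t σ² √θ (N+1)^{1/3}` (a stretched exponential beats any power). [folklore] -/
theorem stub_asymptotics :
    ∀ (t θ σ c C : ℝ), 0 < t → 0 < θ → 0 < σ → 0 < c →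
      ∃ (n : ℕ → ℕ) (M : ℕ → ℝ),
        (∀ N, 0 < n N) ∧
        (∀ N, (n N : ℝ) * (M N * (((N + 1 : ℕ) : ℝ) ^ (-(1 / 3 : ℝ)) / σ ^ 2 / Real.sqrt θ)) = t) ∧
        (∀ᶠ N in atTop, 1 ≤ M N) ∧
        Tendsto (fun N => ((N + 1 : ℕ) : ℝ) * (n N : ℝ) * (C * Real.exp (-c * M N))) atTop
          (nhds 0) := by
  intro t θ σ c C ht hθ hσ hc
  have hsq : 0 < Real.sqrt θ := Real.sqrt_pos.mpr hθ
  have ha : 0 < t * σ ^ 2 * Real.sqrt θ := by positivity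
  have hcast : Tendsto (fun N : ℕ => ((N + 1 : ℕ) : ℝ)) atTop atTop :=
    tendsto_natCast_atTop_atTop.comp (tendsto_add_atTop_nat 1)
  refine ⟨fun _ => 1, fun N => t * σ ^ 2 * Real.sqrt θ * ((N + 1 : ℕ) : ℝ) ^ (1 / 3 : ℝ),
    fun _ => Nat.one_pos, fun N => ?_, ?_, ?_⟩
  · -- the exact product `n_N · (M_N · τ_N) = t`
    have hN : (0 : ℝ) < ((N + 1 : ℕ) : ℝ) := Nat.cast_pos.mpr N.succ_pos
    have h3 : (0 : ℝ) < ((N + 1 : ℕ) : ℝ) ^ (1 / 3 : ℝ) := Real.rpow_pos_of_pos hN _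
    simp only [Nat.cast_one, one_mul]
    rw [Real.rpow_neg hN.le]
    field_simp
  · -- `M_N ≥ 1` eventually, since `M_N → ∞`
    exact (Tendsto.const_mul_atTop ha
      ((tendsto_rpow_atTop (by norm_num : (0 : ℝ) < 1 / 3)).comp hcast)).eventually_ge_atTop 1
  · -- `(N+1) · n_N · C e^{-c M_N} → 0`
    refine ((asymptotics_tendsto_mul_exp_neg_rpow_third _ c C ha hc).comp hcast).congr fun N => ?_
    simp

end Summit.AtomisticToContinuum.HydrodynamicLimit.Theorems.LogWindowTaggedTail
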